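import Summits.ValiantsHypothesis.ValiantsHypothesis.Theorems.AnyonJetsJetConstantElimIntegralMultipleNumberField
import Summits.ValiantsHypothesis.ValiantsHypothesis.Theorems.AnyonJetsJetConstantElimPaddingFormalDegree
import Summits.ValiantsHypothesis.ValiantsHypothesis.Theorems.AnyonJetsJetConstantElimDefs
import Mathlib.NumberTheory.Padics.PadicVal.Basic
import HarnessLib

/-!
# AnyonJets — crux `JetConstantElimTwoAdic` (stmt-ValiantsHypothesis-23655), stub
# `∃ b₁, IntegralMultipleTwoAdicWith b₁`: the FORMAL-DEGREE slice (any denominators)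

Companion of `…IntegralMultipleTwoAdicSlices.lean` (odd common denominator ⇒ `v₂(M) = 0`). Here
the parity clause is traded for FORMAL DEGREE: padding Bürgisser's integer skeleton at its exact
formal degree (`…PaddingFormalDegree.exists_fpadded_circuit`) clears the common denominator `N` of
the (coordinates of the) constants with the multiplier `M = N^(fdeg)`, `fdeg` = the formal degree
of the skeleton of `Q` (`≤ (size Q + 1) ×` the formal degree of `Q`), so that
`v₂(M) = fdeg · v₂(N) ≤ fdeg · h` — polynomial for circuits of polynomial formal degree (the
standard VP normal form, Bürgisser 2000 Def. 2.1(2) / 2009 §2.2), with ANY (dyadic) denominators.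

* `constantFreeComplexity_fdegMultiple_le_of_numberField_circuit` —
  `τ(N^(fdeg) · f) + 2 ≤ 256 (d+1)³ (size Q + h + 2)²` under the bounded-degree bounded-height
  data of `…IntegralMultipleNumberField`.
* `integralMultipleTwoAdic_numberFieldFormalDegreeSlice` — the conclusion of
  `IntegralMultipleTwoAdicWith` with `v₂(M) ≤ fdeg · h`, for EVERY `f ∈ ℤ[x]`.
* `integralMultipleTwoAdicWith_of_heightNormalFormFormalDegree` — **`HNF₃_a →
  IntegralMultipleTwoAdicWith (5a + 12)`**, `HNF₃_a` = height normal form (rank `d+1`, height `h`,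
  size all `≤ X^a`, `X = size Q + n + 2`) with `fdeg (skeleton Q') ≤ X^a` in place of "`N` odd".

With `…TwoAdicSlices`: the open content of the stub of 23655 is the height normal form of
near-optimal circuits of the jets with (odd common denominator OR polynomial formal degree).
Honest framing: free slices and a reduction; the stub, the crux and VP ≠ VNP stay open.
-/

noncomputable section

-- single-conjunct layout: Sub = Summit, duplicated namespace component intended
set_option linter.dupNamespace false

namespace Summit.ValiantsHypothesis.ValiantsHypothesis.Theorems.AnyonJets.JetConstantElim

open MvPolynomial Literature.Computability.AlgebraicComplexity
open Literature.Computability.AlgebraicComplexity.ArithCircuit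
open Summit.ValiantsHypothesis.ValiantsHypothesis.Theorems.AnyonJets.ConstantFreeJetGrowth (jet)
open scoped BigOperators

/-- Envelope arithmetic for the formal-degree slice. [folklore] -/
theorem fdeg_envelope_le (s h d : ℕ) :
    (3 * (d + 1) ^ 3 + (d + 1)) * (4 * (3 * s + 1) ^ 2) +
        ((3 * (h + 1) + 1) + (4 * s + 1) * (d + 1) * (3 * (h + 1) + 1) +
          (d + 1) ^ 3 * (3 * (h + 1) + 1)) + 2 ≤
      256 * (d + 1) ^ 3 * (s + h + 2) ^ 2 := by
  set D := d + 1 with hD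
  set X := s + h + 2 with hX
  have hD1 : 1 ≤ D := by omega
  have hX2 : 2 ≤ X := by omega
  have hD3 : D ≤ D ^ 3 := Nat.le_self_pow (by norm_num) D
  have hD31 : 1 ≤ D ^ 3 := Nat.one_le_pow _ _ hD1
  set T := D ^ 3 * X ^ 2 with hT
  have hT1 : 1 ≤ T := Nat.one_le_iff_ne_zero.mpr (by positivity)
  have h1 : (3 * D ^ 3 + D) * (4 * (3 * s + 1) ^ 2) ≤ 144 * T := by
    have ha : 3 * D ^ 3 + D ≤ 4 * D ^ 3 := by omega
    have hb : 4 * (3 * s + 1) ^ 2 ≤ 36 * X ^ 2 := by nlinarith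
    calc (3 * D ^ 3 + D) * (4 * (3 * s + 1) ^ 2) ≤ (4 * D ^ 3) * (36 * X ^ 2) :=
          Nat.mul_le_mul ha hb
      _ = 144 * T := by rw [hT]; ring
  have hhx : 3 * (h + 1) + 1 ≤ 2 * X ^ 2 := by nlinarith
  have h2 : 3 * (h + 1) + 1 ≤ 2 * T := by
    calc 3 * (h + 1) + 1 ≤ 2 * X ^ 2 := hhx
      _ = 1 * (2 * X ^ 2) := (one_mul _).symm
      _ ≤ D ^ 3 * (2 * X ^ 2) := Nat.mul_le_mul_right _ hD31
      _ = 2 * T := by rw [hT]; ring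
  have h3 : (4 * s + 1) * D * (3 * (h + 1) + 1) ≤ 16 * T := by
    have ha : 4 * s + 1 ≤ 4 * X := by omega
    have hb : 3 * (h + 1) + 1 ≤ 4 * X := by omega
    calc (4 * s + 1) * D * (3 * (h + 1) + 1) ≤ (4 * X) * D ^ 3 * (4 * X) :=
          Nat.mul_le_mul (Nat.mul_le_mul ha hD3) hb
      _ = 16 * T := by rw [hT]; ring
  have h4 : D ^ 3 * (3 * (h + 1) + 1) ≤ 2 * T := by
    calc D ^ 3 * (3 * (h + 1) + 1) ≤ D ^ 3 * (2 * X ^ 2) := Nat.mul_le_mul_left _ hhx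
      _ = 2 * T := by rw [hT]; ring
  have h5 : 256 * (d + 1) ^ 3 * (s + h + 2) ^ 2 = 256 * T := by rw [hT, hD, hX]; ring
  rw [h5]
  omega

/-- **Bounded degree and height, multiplier `N^(fdeg)`**: under the hypotheses of
`exists_integralMultiple_of_numberField_circuit`, `τ(N^(fdeg (skeleton Q)) · f) + 2 ≤
256 (d+1)³ (size Q + h + 2)²` (padding at the formal degree, restriction of scalars,
substitution of the integers). [folklore; Bürgisser 2009 §2.2, BCS 1997 §4.1] -/
theorem constantFreeComplexity_fdegMultiple_le_of_numberField_circuit {σ K : Type*} [Field K]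
    [CharZero K] (f : MvPolynomial σ ℤ) {d : ℕ} (β : Fin (d + 1) → K) (hβ0 : β 0 = 1)
    (hind : LinearIndependent ℚ β) (γ : Fin (d + 1) → Fin (d + 1) → Fin (d + 1) → ℤ)
    (hβ : ∀ a b, β a * β b = ∑ l, (γ a b l : K) * β l)
    (Q : ArithCircuit K σ) (h2 : Q.IsFanInTwo)
    (hc : Q.Computes (MvPolynomial.map (Int.castRingHom K) f)) (N h : ℕ)
    (hNh : N ≤ 2 ^ h) (P : Fin (4 * Q.size + 1) → Fin (d + 1) → ℤ)
    (hP : ∀ v : Fin (4 * Q.size + 1), (N : K) * slotConst Q v = ∑ l, (P v l : K) * β l)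
    (hPh : ∀ v l, (P v l).natAbs ≤ 2 ^ h) (hγh : ∀ a b l, (γ a b l).natAbs ≤ 2 ^ h) :
    constantFreeComplexity (((N : ℤ) ^ (skeleton Q).formalDegree) • f) + 2 ≤
      256 * (d + 1) ^ 3 * (Q.size + h + 2) ^ 2 := by
  classical
  -- (1) skeleton and padding
  obtain ⟨-, Γ', hΓ'2, hΓ's, hΓ'size, hκ⟩ := exists_fpadded_circuit
    (Sum.elim (fun _ => 0) (fun _ => 1) : σ ⊕ Fin (4 * Q.size + 1) → ℕ)
    (by rintro (i | i) <;> simp) (skeleton Q) (isFanInTwo_skeleton Q) (hasSignConstants_skeleton Q)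
  rw [size_skeleton] at hΓ'size
  have hev := aeval_padded_skeleton f Q h2 hc N (fun v => ∑ l, (P v l : K) * β l) hP hκ
  -- (2) reshape the variables: scalar `Option σ` (`none` = z), K-valued `Fin (4s+1)`
  set e : Option (σ ⊕ Fin (4 * Q.size + 1)) → Option σ ⊕ Fin (4 * Q.size + 1) :=
    fun o => Option.elim o (Sum.inl none) (Sum.elim (fun x => Sum.inl (some x)) Sum.inr) with he
  have hΓ''2 : (Γ'.rename e).IsFanInTwo := hΓ'2.rename e
  have hΓ''s : (Γ'.rename e).HasSignConstants := hΓ's.rename e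
  have hΓ''size : (Γ'.rename e).size = Γ'.size := size_rename e Γ'
  have hΓ''eval : (Γ'.rename e).eval = rename e Γ'.eval := eval_rename_apply e Γ'
  -- (3) the coordinate data
  set ρK : Option σ ⊕ Fin (4 * Q.size + 1) → MvPolynomial σ K :=
    Sum.elim (fun a => Option.elim a (C (N : K)) X) (fun v => C (∑ l, (P v l : K) * β l)) with hρK
  set ρZ : Option σ ⊕ ((Fin (4 * Q.size + 1) × Fin (d + 1)) ⊕ (Fin (d + 1) × Fin (d + 1) × Fin (d + 1))) →
      MvPolynomial σ ℤ :=
    Sum.elim (fun a => Option.elim a (C (N : ℤ)) X)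
      (Sum.elim (fun vl => C (P vl.1 vl.2)) (fun abl => C (γ abl.1 abl.2.1 abl.2.2))) with hρZ
  have hsc : ∀ a, ρK (Sum.inl a) = MvPolynomial.map (Int.castRingHom K) (ρZ (Sum.inl a)) := by
    rintro (_ | x) <;> simp [hρK, hρZ]
  have hK : ∀ v, ρK (Sum.inr v) = ∑ l : Fin (d + 1), C (β l) *
      MvPolynomial.map (Int.castRingHom K) (ρZ (Sum.inr (Sum.inl (v, l)))) := by
    intro v
    simp only [hρK, hρZ, Sum.elim_inr, Sum.elim_inl, map_sum, map_mul, map_intCast, eq_intCast]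
    exact Finset.sum_congr rfl fun l _ => mul_comm _ _
  have hβ' : ∀ a b : Fin (d + 1), C (β a) * C (β b) = ∑ l : Fin (d + 1),
      MvPolynomial.map (Int.castRingHom K) (ρZ (Sum.inr (Sum.inr (a, b, l)))) * C (β l) := by
    intro a b
    rw [← map_mul, hβ, map_sum]
    exact Finset.sum_congr rfl fun l _ => by simp [hρZ]
  obtain ⟨Γc, q, hΓc2, hΓcs, hΓcsize, hΓceval, hI⟩ :=
    exists_coordinate_circuit hβ0 hsc hK hβ' (Γ'.rename e) hΓ''2 hΓ''s
  -- (4) the unit coordinate is `N^E • f`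
  have hρe : (ρK ∘ e) = fun o : Option (σ ⊕ Fin (4 * Q.size + 1)) =>
      Option.elim o (C (N : K)) (Sum.elim X (fun v => C (∑ l, (P v l : K) * β l))) := by
    funext o
    rcases o with _ | (x | v) <;> simp [hρK, he]
  have hstar : ∑ l : Fin (d + 1), C (β l) * MvPolynomial.map (Int.castRingHom K) (aeval ρZ (q l)) =
      MvPolynomial.map (Int.castRingHom K) (((N : ℤ) ^ (skeleton Q).formalDegree) • f) := by
    rw [← hI, hΓ''eval, aeval_rename, hρe, hev, smul_eq_C_mul, map_mul, map_C]
    simp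
  have hA0 : aeval ρZ (q 0) = ((N : ℤ) ^ (skeleton Q).formalDegree) • f :=
    eq_of_sum_C_mul_map_eq β hβ0 hind (fun l => aeval ρZ (q l)) _ hstar
  -- (5) substituting the integers: cost
  set g' : Unit ⊕ ((Fin (4 * Q.size + 1) × Fin (d + 1)) ⊕ (Fin (d + 1) × Fin (d + 1) × Fin (d + 1))) →
      MvPolynomial σ ℤ :=
    Sum.elim (fun _ => C (N : ℤ))
      (Sum.elim (fun vl => C (P vl.1 vl.2)) (fun abl => C (γ abl.1 abl.2.1 abl.2.2))) with hg'
  set e₂ : Option σ ⊕ ((Fin (4 * Q.size + 1) × Fin (d + 1)) ⊕ (Fin (d + 1) × Fin (d + 1) × Fin (d + 1))) →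
      σ ⊕ (Unit ⊕ ((Fin (4 * Q.size + 1) × Fin (d + 1)) ⊕ (Fin (d + 1) × Fin (d + 1) × Fin (d + 1)))) :=
    Sum.elim (fun a => Option.elim a (Sum.inr (Sum.inl ())) Sum.inl) (fun r => Sum.inr (Sum.inr r))
    with he₂
  have hρZe : ρZ = (Sum.elim X g') ∘ e₂ := by
    funext x
    rcases x with (_ | x) | (vl | abl) <;> simp [hρZ, hg', he₂]
  have hconst : ∀ z : ℤ, z.natAbs ≤ 2 ^ h →
      constantFreeComplexity (C z : MvPolynomial σ ℤ) ≤ 3 * (h + 1) + 1 :=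
    fun z hz => constantFreeComplexity_C_le_of_natAbs_le hz
  have hcost : constantFreeComplexity (((N : ℤ) ^ (skeleton Q).formalDegree) • f) ≤
      Γc.size + ((3 * (h + 1) + 1) + ((4 * Q.size + 1) * (d + 1) * (3 * (h + 1) + 1) +
        (d + 1) ^ 3 * (3 * (h + 1) + 1))) := by
    rw [← hA0, ← hΓceval, hρZe, ← aeval_rename]
    refine (constantFreeComplexity_aeval_sumElim_le_fintype _ _).trans (add_le_add ?_ ?_)
    · exact (constantFreeComplexity_rename_le _ _).trans
        (constantFreeComplexity_le_size hΓc2 hΓcs rfl)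
    · rw [Fintype.sum_sum_type, Fintype.sum_sum_type, Fintype.sum_unique]
      refine add_le_add ?_ (add_le_add ?_ ?_)
      · simpa [hg'] using hconst (N : ℤ) (by simpa using hNh)
      · refine (Finset.sum_le_card_nsmul _ _ (3 * (h + 1) + 1) fun vl _ => ?_).trans (le_of_eq ?_)
        · simpa [hg'] using hconst _ (hPh vl.1 vl.2)
        · simp only [Finset.card_univ, Fintype.card_prod, Fintype.card_fin, smul_eq_mul]
      · refine (Finset.sum_le_card_nsmul _ _ (3 * (h + 1) + 1) fun abl _ => ?_).trans (le_of_eq ?_)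
        · simpa [hg'] using hconst _ (hγh abl.1 abl.2.1 abl.2.2)
        · simp only [Finset.card_univ, Fintype.card_prod, Fintype.card_fin, smul_eq_mul]
          ring
  have henv := fdeg_envelope_le Q.size h d
  have hsizes : Γc.size ≤ (3 * (d + 1) ^ 3 + (d + 1)) * (4 * (3 * Q.size + 1) ^ 2) :=
    hΓcsize.trans (Nat.mul_le_mul_left _ (by rw [hΓ''size]; exact hΓ'size))
  omega


/-- **The formal-degree slice of `IntegralMultipleTwoAdicWith`** (every `f`): as
`integralMultipleTwoAdic_numberFieldOddSlice` but with ANY common denominator `N ≥ 1`; the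
multiplier `M = N^(fdeg (skeleton Q))` has `v₂(M) ≤ fdeg (skeleton Q) · h`. [folklore] -/
theorem integralMultipleTwoAdic_numberFieldFormalDegreeSlice {σ K : Type*} [Field K] [CharZero K]
    (f : MvPolynomial σ ℤ) {d : ℕ} (β : Fin (d + 1) → K) (hβ0 : β 0 = 1)
    (hind : LinearIndependent ℚ β) (γ : Fin (d + 1) → Fin (d + 1) → Fin (d + 1) → ℤ)
    (hβ : ∀ a b, β a * β b = ∑ l, (γ a b l : K) * β l)
    (Q : ArithCircuit K σ) (h2 : Q.IsFanInTwo)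
    (hc : Q.Computes (MvPolynomial.map (Int.castRingHom K) f)) (N h : ℕ) (hN1 : 1 ≤ N)
    (hNh : N ≤ 2 ^ h) (P : Fin (4 * Q.size + 1) → Fin (d + 1) → ℤ)
    (hP : ∀ v : Fin (4 * Q.size + 1), (N : K) * slotConst Q v = ∑ l, (P v l : K) * β l)
    (hPh : ∀ v l, (P v l).natAbs ≤ 2 ^ h) (hγh : ∀ a b l, (γ a b l).natAbs ≤ 2 ^ h) :
    ∃ (Pc : ArithCircuit ℤ σ) (t M : ℕ),
      1 ≤ M ∧ Pc.IsFanInTwo ∧ Pc.Computes ((M : ℤ) • f) ∧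
      ((∀ g ∈ Pc.gates, ∀ u ∈ g.args, ∀ c : ℤ, u = .const c → c.natAbs ≤ 2 ^ t) ∧
        (∀ args : List (ℤ × Operand ℤ σ), Gate.sum args ∈ Pc.gates →
          ∀ a ∈ args, a.1.natAbs ≤ 2 ^ t) ∧
        (∀ c : ℤ, Pc.output = .const c → c.natAbs ≤ 2 ^ t)) ∧
      Pc.size + t + 2 ≤ 256 * (d + 1) ^ 3 * (Q.size + h + 2) ^ 2 ∧
      padicValNat 2 M ≤ (skeleton Q).formalDegree * h := by
  have hτ := constantFreeComplexity_fdegMultiple_le_of_numberField_circuit f β hβ0 hind γ hβ Q h2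
    hc N h hNh P hP hPh hγh
  obtain ⟨PC, hP2, hPs, hPc, hPsize⟩ :=
    exists_computes_size_eq_constantFreeComplexity (((N : ℤ) ^ (skeleton Q).formalDegree) • f)
  have hsgn : ∀ c : ℤ, IsSignConstant c → c.natAbs ≤ 2 ^ 0 := by
    rintro c (hc0 | hc0 | hc0)
    · subst hc0; simp
    · subst hc0; simp
    · obtain rfl : c = -1 := by omega
      simp
  have hheight : (∀ g ∈ PC.gates, ∀ u ∈ g.args, ∀ c : ℤ, u = .const c → c.natAbs ≤ 2 ^ 0) ∧
      (∀ args : List (ℤ × Operand ℤ σ), Gate.sum args ∈ PC.gates →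
        ∀ a ∈ args, a.1.natAbs ≤ 2 ^ 0) ∧
      (∀ c : ℤ, PC.output = .const c → c.natAbs ≤ 2 ^ 0) := by
    obtain ⟨hg, ho⟩ := hPs
    refine ⟨?_, fun args hargs a ha => hsgn _ ((hg _ hargs) a ha).1, fun c hcO => hsgn _ (by
      rw [hcO] at ho; exact ho)⟩
    intro g hgP u hu c huc
    subst huc
    have hgs := hg g hgP
    cases g with
    | sum args =>
      simp only [Gate.args, List.mem_map] at hu
      obtain ⟨a, ha, hau⟩ := hu
      have hh := (hgs a ha).2
      rw [hau] at hh
      exact hsgn _ hh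
    | prod args => exact hsgn _ (hgs _ hu)
  have hv : padicValNat 2 (N ^ (skeleton Q).formalDegree) ≤ (skeleton Q).formalDegree * h := by
    rw [padicValNat.pow N ((skeleton Q).formalDegree)]
    refine Nat.mul_le_mul_left _ ((padicValNat_le_nat_log N).trans ?_)
    calc Nat.log 2 N ≤ Nat.log 2 (2 ^ h) := Nat.log_mono_right hNh
      _ = h := Nat.log_pow (by norm_num) h
  exact ⟨PC, 0, N ^ (skeleton Q).formalDegree, Nat.one_le_pow _ _ hN1, hP2,
    by simpa [Nat.cast_pow] using hPc, hheight, by omega, hv⟩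

/-- Envelope arithmetic: `256 D³ (s' + h + 2)² ≤ X^(5a+12)` when `D, s', h ≤ X^a`, `X ≥ 2`.
[folklore] -/
theorem heightNormalFormFdeg_envelope_le {X a D s' h : ℕ} (hX : 2 ≤ X) (hD : D ≤ X ^ a)
    (hs : s' ≤ X ^ a) (hh : h ≤ X ^ a) :
    256 * D ^ 3 * (s' + h + 2) ^ 2 ≤ X ^ (5 * a + 12) := by
  have hXa : 1 ≤ X ^ a := Nat.one_le_pow _ _ (by omega)
  have h1 : s' + h + 2 ≤ 4 * X ^ a := by omega
  have h2 : (s' + h + 2) ^ 2 ≤ 16 * (X ^ a) ^ 2 := by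
    calc (s' + h + 2) ^ 2 ≤ (4 * X ^ a) ^ 2 := Nat.pow_le_pow_left h1 2
      _ = 16 * (X ^ a) ^ 2 := by ring
  have h3 : D ^ 3 ≤ (X ^ a) ^ 3 := Nat.pow_le_pow_left hD 3
  have h4 : 2 ^ 12 ≤ X ^ 12 := Nat.pow_le_pow_left hX 12
  calc 256 * D ^ 3 * (s' + h + 2) ^ 2 ≤ 256 * (X ^ a) ^ 3 * (16 * (X ^ a) ^ 2) :=
        Nat.mul_le_mul (Nat.mul_le_mul_left _ h3) h2
    _ = 2 ^ 12 * X ^ (5 * a) := by ring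
    _ ≤ X ^ 12 * X ^ (5 * a) := Nat.mul_le_mul_right _ h4
    _ = X ^ (5 * a + 12) := by rw [← pow_add]; ring_nf

/-- **`HNF₃_a → IntegralMultipleTwoAdicWith (5a + 12)`**: the one open stub of the attacked crux
`JetConstantElimTwoAdic` (stmt-23655) follows from the height normal form of near-optimal
`ℚ̄`-circuits of the jets in which the parity clause of
`integralMultipleTwoAdicWith_of_heightNormalFormOdd` is replaced by a bound `≤ X^a` on the FORMAL
DEGREE of the skeleton of the replacement circuit `Q'` (dyadic denominators allowed).
[folklore] -/
theorem integralMultipleTwoAdicWith_of_heightNormalFormFormalDegree (a : ℕ)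
    (hHNF : ∀ n k : ℕ, k ≤ Nat.log 2 n →
      ∀ Q : ArithCircuit (AlgebraicClosure ℚ) (Fin n × Fin n), Q.IsFanInTwo →
        Q.Computes (MvPolynomial.map (Int.castRingHom (AlgebraicClosure ℚ)) (jet n k)) →
        ∃ (d : ℕ) (β : Fin (d + 1) → AlgebraicClosure ℚ)
          (γ : Fin (d + 1) → Fin (d + 1) → Fin (d + 1) → ℤ)
          (Q' : ArithCircuit (AlgebraicClosure ℚ) (Fin n × Fin n)) (N h : ℕ)
          (P : Fin (4 * Q'.size + 1) → Fin (d + 1) → ℤ),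
          β 0 = 1 ∧ LinearIndependent ℚ β ∧
          (∀ a b, β a * β b = ∑ l, (γ a b l : AlgebraicClosure ℚ) * β l) ∧
          Q'.IsFanInTwo ∧
          Q'.Computes (MvPolynomial.map (Int.castRingHom (AlgebraicClosure ℚ)) (jet n k)) ∧
          1 ≤ N ∧ N ≤ 2 ^ h ∧
          (∀ v : Fin (4 * Q'.size + 1),
            (N : AlgebraicClosure ℚ) * slotConst Q' v = ∑ l, (P v l : AlgebraicClosure ℚ) * β l) ∧
          (∀ v l, (P v l).natAbs ≤ 2 ^ h) ∧ (∀ a b l, (γ a b l).natAbs ≤ 2 ^ h) ∧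
          d + 1 ≤ (Q.size + n + 2) ^ a ∧ h ≤ (Q.size + n + 2) ^ a ∧
          Q'.size ≤ (Q.size + n + 2) ^ a ∧ (skeleton Q').formalDegree ≤ (Q.size + n + 2) ^ a) :
    IntegralMultipleTwoAdicWith (5 * a + 12) := by
  intro n k hk Q hQ2 hQc
  obtain ⟨d, β, γ, Q', N, h, P, hβ0, hind, hβ, hQ'2, hQ'c, hN1, hNh, hP, hPh, hγh, hd, hh, hs, hfd⟩ :=
    hHNF n k hk Q hQ2 hQc
  obtain ⟨Pc, t, M, hM, hPc2, hPcc, hPch, hPcsize, hv⟩ :=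
    integralMultipleTwoAdic_numberFieldFormalDegreeSlice (jet n k) β hβ0 hind γ hβ Q' hQ'2 hQ'c N h
      hN1 hNh P hP hPh hγh
  have hX : 2 ≤ Q.size + n + 2 := by omega
  have henv := heightNormalFormFdeg_envelope_le (a := a) hX hd hs hh
  refine ⟨Pc, t, M, hM, hPc2, hPcc, hPch, hPcsize.trans henv, hv.trans ?_⟩
  calc (skeleton Q').formalDegree * h ≤ (Q.size + n + 2) ^ a * (Q.size + n + 2) ^ a :=
        Nat.mul_le_mul hfd hh
    _ = (Q.size + n + 2) ^ (2 * a) := by rw [← pow_add]; ring_nf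
    _ ≤ (Q.size + n + 2) ^ (5 * a + 12) := Nat.pow_le_pow_right (by omega) (by omega)

end Summit.ValiantsHypothesis.ValiantsHypothesis.Theorems.AnyonJets.JetConstantElim

end
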